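import Literature.NumberTheory.Automorphic.TorusCharacterSplitRigidityLocal
import HarnessLib

/-!
# Rigidity of automorphic characters of the norm-one torus `T = U(1)_{K/F₀}` from ALL BUT FINITELY MANY finite places
# (multiplicity one for the rational torus; Cassels–Fröhlich Ch. VII §4 Prop. 4.1 «`k^* J_k^S` is dense in `J_k`»; idelic Hilbert 90)

Topic `NumberTheory/Automorphic`; namespace `Literature.NumberTheory.Automorphic.UnitaryGroup`.  PROOF FILE (theorems only; no definition,
no named fact, no instance, no notation, no `sorry`), companion of ★ `TorusCharacterSplitRigidity` ∕ ★ `TorusCharacterSplitRigidityLocal`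
(rigidity from the SPLIT places, with NO hypothesis at the non-split places — weak approximation for the anisotropic torus).  Setting as there:
`K/F₀` quadratic with non-trivial automorphism `c` (`h2`, `hc`), `T(𝔸_{F₀}) = TorusDict.torus c ≤ 𝕀_K`, automorphic characters
`ψ : T(𝔸_{F₀}) →ₜ* ℂˣ`, base change `χ̃ = TorusDict.pullback ψ = ψ ∘ (z ↦ c • z / z)` (a Hecke character of `K`).

THE THEOREM (finite exceptional set, the shape «local components agree off a finite set of places»).  **An automorphic character of
`T(𝔸_{F₀})` whose base change is trivial on `K_wˣ` for every finite place `w` of `K` OUTSIDE A FINITE SET `S` is trivial**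
(`torusCharacter_eq_one_of_forall_not_mem`); hence two automorphic characters whose base changes have the same local components off `S`
are equal (`torusCharacter_eq_of_localComponent_eq_of_not_mem`), and — in the torus-local currency `ξ_v = torusLocalComponent v ψ` of ★
`TorusCharacterLocalComponents` — two automorphic characters with `ξ_v = ξ′_v` at every finite place `v` of `F₀` outside a finite set `S₀`
are equal (`torusCharacter_eq_of_torusLocalComponent_eq_of_not_mem`; the `ψ = 1` form `torusCharacter_eq_one_of_torusLocalComponent_eq_one_of_not_mem`).
PROOF: unlike the split-places theorem (which has NO information at the non-split places and needs their compactness), here Tate's density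
«`K^× 𝕀_K^S` is dense in `𝕀_K`» applies VERBATIM to the base change: ★ `HeckeCharacter.eq_one_of_forall_localUnits` (finite `S`) gives
`χ̃ = 1`, and the twist `𝕀_K → T(𝔸_{F₀})` is onto (idelic Hilbert 90, ★ `TorusDict.twistToTorus_surjective`), so `ψ = 1`.
USE (Hodge-CM programme, floor 0, crux H413 line LH7, (PK-A-H) rigidity on `H = U(2) × U(1)`): two one-dimensional automorphic `ξ = (η, ψ)`,
`ξ′` whose local characters agree at all but finitely many finite places are equal — the «strong multiplicity one for characters» input
`hglobH` of ★ `F0P3SpectralPacketRigidityReductionH.xiRigidityH_of_fibre`.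

## References
* J. W. S. Cassels, A. Fröhlich (eds.), *Algebraic Number Theory* (1967), Ch. VII (Tate) §4 Prop. 4.1 and its proof («`k^* J_k^S` is dense
  in `J_k`»), Ch. II §6 [CasselsFrohlichANT1967].
* V. Platonov, A. Rapinchuk, *Algebraic Groups and Number Theory* (1994), §7.3 Prop. 7.8 [PlatonovRapinchuk1994].
-/

set_option autoImplicit false

noncomputable section

open NumberField IsDedekindDomain
open Literature.NumberTheory.GaloisRepresentations
open Literature.NumberTheory.Automorphic.Arthur2013.Leaves.TECR

namespace Literature.NumberTheory.Automorphic

namespace UnitaryGroup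

variable {F₀ K : Type} [Field F₀] [NumberField F₀] [Field K] [NumberField K] [Algebra F₀ K]
  (c : K ≃ₐ[F₀] K) (h2 : Module.finrank F₀ K = 2) (hc : c ≠ 1)

/-! ## §1 Base-change currency: trivial on `K_wˣ` off a finite set ⇒ trivial -/

/-- **An automorphic character of `T(𝔸_{F₀})` whose base change `χ̃ = ψ ∘ (z ↦ c • z / z)` is trivial on `K_wˣ` for every finite place `w`
of `K` outside a finite set `S` is trivial**: `χ̃ = 1` by Tate's density `K^× 𝕀_K^S ⊂ 𝕀_K` dense (★ `HeckeCharacter.eq_one_of_forall_localUnits`),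
and the twist `𝕀_K → T(𝔸_{F₀})` is onto (idelic Hilbert 90). [cite: CasselsFrohlichANT1967, Ch. VII §4 Prop. 4.1 (proof)] [cite: PlatonovRapinchuk1994, §7.3 Prop. 7.8] -/
theorem torusCharacter_eq_one_of_forall_not_mem (S : Finset (HeightOneSpectrum (𝓞 K))) (ψ : ↥(TorusDict.torus c) →ₜ* ℂˣ)
    (hψ : TorusDict.IsAutomorphic c ψ)
    (h : ∀ w : HeightOneSpectrum (𝓞 K), w ∉ S → ∀ a : (w.adicCompletion K)ˣ, TorusDict.pullback c h2 hc ψ hψ (localUnits w a) = 1) :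
    ψ = 1 := by
  have hχ : TorusDict.pullback c h2 hc ψ hψ = 1 := HeckeCharacter.eq_one_of_forall_localUnits (S := S) h
  refine ContinuousMonoidHom.ext fun t => ?_
  obtain ⟨z, rfl⟩ := TorusDict.twistToTorus_surjective c h2 hc t
  rw [← TorusDict.pullback_apply c h2 hc ψ hψ, hχ]
  rfl

/-- **RIGIDITY OFF A FINITE SET (base-change currency).**  Two automorphic characters of `T(𝔸_{F₀})` whose base changes have the same local
component `χ̃_w = χ̃′_w` at every finite place `w` of `K` outside a finite set `S` are equal.
[cite: CasselsFrohlichANT1967, Ch. VII §4 Prop. 4.1 (proof)] [cite: PlatonovRapinchuk1994, §7.3 Prop. 7.8] -/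
theorem torusCharacter_eq_of_localComponent_eq_of_not_mem (S : Finset (HeightOneSpectrum (𝓞 K))) (ψ ψ' : ↥(TorusDict.torus c) →ₜ* ℂˣ)
    (hψ : TorusDict.IsAutomorphic c ψ) (hψ' : TorusDict.IsAutomorphic c ψ')
    (h : ∀ w : HeightOneSpectrum (𝓞 K), w ∉ S →
      (TorusDict.pullback c h2 hc ψ hψ).localComponent w = (TorusDict.pullback c h2 hc ψ' hψ').localComponent w) :
    ψ = ψ' := by
  have h1 : ψ * ψ'⁻¹ = 1 := by
    refine torusCharacter_eq_one_of_forall_not_mem c h2 hc S (ψ * ψ'⁻¹) (isAutomorphic_mul_inv c hψ hψ') fun w hw a => ?_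
    rw [pullback_mul_inv_apply c h2 hc hψ hψ', ← HeckeCharacter.localComponent_apply, ← HeckeCharacter.localComponent_apply, h w hw,
      mul_inv_cancel]
  exact mul_inv_eq_one.1 h1

/-! ## §2 Torus-local currency `ξ_v` off a finite set of places of `F₀` -/

include h2 hc in
/-- **RIGIDITY OFF A FINITE SET (torus-local currency `ξ_v`).**  Two automorphic characters `ψ, ψ′` of `T(𝔸_{F₀})` with the same local component
`ξ_v = ξ′_v : T(F₀,v) → ℂˣ` (★ `torusLocalComponent`) at every finite place `v` of `F₀` outside a finite set `S₀` are equal (the places of `K` above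
`S₀` form a finite set; ★ `pullback_semilocalComponent` converts currencies at every place, split or not).
[cite: CasselsFrohlichANT1967, Ch. VII §4 Prop. 4.1 (proof)] [cite: PlatonovRapinchuk1994, §7.3 Prop. 7.8] -/
theorem torusCharacter_eq_of_torusLocalComponent_eq_of_not_mem (S₀ : Finset (HeightOneSpectrum (𝓞 F₀))) (ψ ψ' : ↥(TorusDict.torus c) →ₜ* ℂˣ)
    (hψ : TorusDict.IsAutomorphic c ψ) (hψ' : TorusDict.IsAutomorphic c ψ')
    (h : ∀ v : HeightOneSpectrum (𝓞 F₀), v ∉ S₀ → torusLocalComponent K c v ψ = torusLocalComponent K c v ψ') :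
    ψ = ψ' := by
  classical
  -- the places of `K` over `S₀` form a finite set (each fibre `PlacesOver K v` is finite)
  have hfin : {w : HeightOneSpectrum (𝓞 K) | w.under (𝓞 F₀) ∈ (S₀ : Set (HeightOneSpectrum (𝓞 F₀)))}.Finite := by
    refine Set.Finite.subset (Set.Finite.biUnion S₀.finite_toSet fun v _ => (Set.finite_range (fun w : PlacesOver K v => w.1))) ?_
    intro w hw
    exact Set.mem_biUnion hw ⟨⟨w, rfl⟩, rfl⟩
  refine torusCharacter_eq_of_localComponent_eq_of_not_mem c h2 hc hfin.toFinset ψ ψ' hψ hψ' fun w hw => MonoidHom.ext fun a => ?_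
  have hv : w.under (𝓞 F₀) ∉ S₀ := fun hm => hw (hfin.mem_toFinset.2 hm)
  set W : PlacesOver K (w.under (𝓞 F₀)) := ⟨w, rfl⟩ with hW
  set u : (LocalRing K (w.under (𝓞 F₀)))ˣ :=
    (MulEquiv.piUnits (M := fun w' : PlacesOver K (w.under (𝓞 F₀)) => w'.1.adicCompletion K)).symm
      (Pi.mulSingle W a) with hu
  have e1 := pullback_semilocalComponent K c h2 hc ψ hψ u
  have e2 := pullback_semilocalComponent K c h2 hc ψ' hψ' u
  rw [semilocalComponent_apply, hu, semilocalUnits_piUnits_symm_mulSingle] at e1 e2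
  rw [HeckeCharacter.localComponent_apply, HeckeCharacter.localComponent_apply, e1, e2, h _ hv]

include h2 hc in
/-- The `ψ = 1` form in the torus-local currency: an automorphic character of `T(𝔸_{F₀})` with trivial local component at every finite place
outside a finite set is trivial. [cite: CasselsFrohlichANT1967, Ch. VII §4 Prop. 4.1 (proof)] [cite: PlatonovRapinchuk1994, §7.3 Prop. 7.8] -/
theorem torusCharacter_eq_one_of_torusLocalComponent_eq_one_of_not_mem (S₀ : Finset (HeightOneSpectrum (𝓞 F₀))) (ψ : ↥(TorusDict.torus c) →ₜ* ℂˣ)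
    (hψ : TorusDict.IsAutomorphic c ψ)
    (h : ∀ v : HeightOneSpectrum (𝓞 F₀), v ∉ S₀ → torusLocalComponent K c v ψ = 1) :
    ψ = 1 :=
  torusCharacter_eq_of_torusLocalComponent_eq_of_not_mem c h2 hc S₀ ψ 1 hψ (fun _ _ => rfl) fun v hv => by
    rw [h v hv]; rfl

end UnitaryGroup

end Literature.NumberTheory.Automorphic

end
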